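import Mathlib
import Summits.Ventures.PercRepro2.A3CutFMoTerms

/-!
# The cut-vertex closure of (FM) when the mark `o` lies on the part's side
(blind cell PercRepro2, night-1 g32; proofs/NIGHT1-G32.md §6)

Setting of A3CutExpand but with `o ∈ VA` (the side of `v`) and `a₁, a₂, b ∈ VB ∪ {x}`.  `FMfun` is LINEAR
in the `o`-data (A3CutFMoFibres: `F⁰ = σ₃ γ₀` on every fibre of `x`), and on the `A`-internal fibres of
`v` the `o`-contributions `P_A(v ↮ x, o ↔ x) · (B-side masses)` cancel between the ratio and the product
terms exactly as the unconditioned ones do in `FMfun_cut` (A3CutFMoTerms).  Hence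

  **`FMfun_cut_oA`**: `FMfun(v) = P(v ↔ x) · FMfun(x)` also when `o` lies on the part's side,

and `FM_cut_oA_of`.  Exact census before the proof: check_cut_o.py (150) + check_cut_mixed2.py (70):
220/220; the expansion of `btw` and the closure with `b` or a root on the part's side FAIL there.
Standard axioms.
-/

namespace Summit.Ventures.PercRepro2

open UnionCluster CovForm CutV

namespace CovForm

namespace A3Fibre

section OSideClosure

variable {V : Type*} {E : Type*} [Fintype V] [DecidableEq V] [Fintype E] [DecidableEq E]
  {R : Type*} [Field R] [LinearOrder R] [IsStrictOrderedRing R] {ends : E → Sym2 V} {x : V}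
  {VA VB : Finset V} {EA EB : Set E} [DecidablePred (· ∈ EA)] [DecidablePred (· ∈ EB)] {p : E → R}
  {o a₁ a₂ b v : V}

/-- **The cut-vertex closure of (FM) with `o` on the part's side**: `FMfun(v) = P(v ↔ x) · FMfun(x)`. -/
theorem FMfun_cut_oA (hp : IsProbVec p) (h : IsCut ends x ↑VA ↑VB EA EB) (ho : o ∈ VA) (hv : v ∈ VA)
    (h1 : a₁ ∈ insert x VB) (h2 : a₂ ∈ insert x VB) (hb : b ∈ insert x VB)
    (hQ : prob p (avoidAll ends a₂ {a₁}) ≠ 0) :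
    FMfun p ends o a₁ a₂ v b = prob p (connEvent ends v x) * FMfun p ends o a₁ a₂ x b := by
  have hA : ∑ W : Finset V, Ssig p ends a₁ a₂ x b W =
      prob p (avoidAll ends a₂ {a₁} ∩ connEvent ends a₁ b) -
        prob p (avoidAll ends a₂ {a₁} ∩ connEvent ends a₂ b) := by
    rw [← EQo_eq p ends b a₁ a₂ x]
    rfl
  have hD := prob_PD_cut (p := p) (o := b) h hb h1 h2 hb hv
  have hSb := sum_Ssig_cut (p := p) (o := b) h hb h1 h2 hb hv
  have hnb := sum_SuA_cut (p := p) (o := b) h hb h1 h2 hb hv (Or.inl rfl)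
  -- the Z-restricted `s3`-sums scale
  have hLb : ∑ W : Finset V, (if x ∈ W then s3 a₁ a₂ W * (LeafStep.mU p ends a₁ a₂ o / prob p (avoidAll ends a₂ {a₁})) *
      SsigZ p ends a₁ a₂ x b (connEvent ends v x) W else 0) =
      prob p (connEvent ends v x) * ((LeafStep.mU p ends a₁ a₂ o / prob p (avoidAll ends a₂ {a₁})) *
        ∑ W : Finset V, s3 a₁ a₂ W * Ssig p ends a₁ a₂ x b W) := by
    have e : ∀ W : Finset V, (if x ∈ W then s3 a₁ a₂ W *
        (LeafStep.mU p ends a₁ a₂ o / prob p (avoidAll ends a₂ {a₁})) *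
        SsigZ p ends a₁ a₂ x b (connEvent ends v x) W else 0) =
        (LeafStep.mU p ends a₁ a₂ o / prob p (avoidAll ends a₂ {a₁})) *
          (s3 a₁ a₂ W * SsigZ p ends a₁ a₂ x b (connEvent ends v x) W) := by
      intro W
      split_ifs with hxW
      · ring
      · rw [SsigZ_eq_zero_of_empty _ (clusterEvent_x_eq_empty_of_notMem (ends := ends) hxW)]
        ring
    simp_rw [e]
    rw [← Finset.mul_sum, connEvent_vx_eq_sideEvent h hv,
      sum_fibre_x_scale (o := b) h hb h1 h2 hb (connEvent ends v x) (fun W _ sb _ _ _ => s3 a₁ a₂ W * sb)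
        (fun W => by simp) (fun W (c m sb so ub uo : R) => by ring) (fun S hS W => by
          funext m sb so ub uo
          rw [s3_union_left (fun hc => notMem_VA_of_mem_VB h h1 (hS hc))
            (fun hc => notMem_VA_of_mem_VB h h2 (hS hc))])]
    ring
  have hLm : ∑ W : Finset V, (if x ∈ W then s3 a₁ a₂ W * (LeafStep.mU p ends a₁ a₂ o / prob p (avoidAll ends a₂ {a₁})) *
      mZ p ends a₁ a₂ x (connEvent ends v x) W else 0) =
      prob p (connEvent ends v x) * ((LeafStep.mU p ends a₁ a₂ o / prob p (avoidAll ends a₂ {a₁})) *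
        ∑ W : Finset V, s3 a₁ a₂ W * mW p ends a₁ a₂ x W) := by
    have e : ∀ W : Finset V, (if x ∈ W then s3 a₁ a₂ W *
        (LeafStep.mU p ends a₁ a₂ o / prob p (avoidAll ends a₂ {a₁})) *
        mZ p ends a₁ a₂ x (connEvent ends v x) W else 0) =
        (LeafStep.mU p ends a₁ a₂ o / prob p (avoidAll ends a₂ {a₁})) *
          (s3 a₁ a₂ W * mZ p ends a₁ a₂ x (connEvent ends v x) W) := by
      intro W
      split_ifs with hxW
      · ring
      · rw [mZ_eq_zero_of_empty _ (clusterEvent_x_eq_empty_of_notMem (ends := ends) hxW)]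
        ring
    simp_rw [e]
    rw [← Finset.mul_sum, connEvent_vx_eq_sideEvent h hv,
      sum_fibre_x_scale (o := b) h hb h1 h2 hb (connEvent ends v x) (fun W m _ _ _ _ => s3 a₁ a₂ W * m)
        (fun W => by simp) (fun W (c m sb so ub uo : R) => by ring) (fun S hS W => by
          funext m sb so ub uo
          rw [s3_union_left (fun hc => notMem_VA_of_mem_VB h h1 (hS hc))
            (fun hc => notMem_VA_of_mem_VB h h2 (hS hc))])]
    ring
  have hd := sum_aZo_notMem (p := p) (ends := ends) (x := x) (EA := EA) (o := o) (v := v)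
  unfold FMfun gamma0
  rw [Finset.sum_congr rfl (fun W _ => term_v_oA hp h ho hv h1 h2 hb _ W),
    Finset.sum_congr rfl (fun W _ => SFg_v_oA hp h ho hv h1 h2 _ W), fibresA, Finset.sum_filter,
    Finset.sum_filter, Finset.sum_filter, Finset.sum_filter, Finset.sum_filter, Finset.sum_filter,
    Finset.sum_congr rfl (fun W _ => termA_v_oA hp h ho hv h1 h2 hb W),
    Finset.sum_congr rfl (fun W _ => SuA_o_v_oA hp h ho hv h1 h2 W),
    sum_ite_mem_split (fun W => s3 a₁ a₂ W * (LeafStep.mU p ends a₁ a₂ o / prob p (avoidAll ends a₂ {a₁})) *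
        SsigZ p ends a₁ a₂ x b (connEvent ends v x) W)
      (fun W => (prob p (avoidAll ends a₂ {a₁} ∩ connEvent ends a₁ b) -
            prob p (avoidAll ends a₂ {a₁} ∩ connEvent ends a₂ b)) *
          (prob p (avoidAll ends a₂ {a₁} ∩ connEvent ends x a₁) -
            prob p (avoidAll ends a₂ {a₁} ∩ connEvent ends x a₂)) *
          prob p (sideEvent EA (clusterEvent ends v (↑W : Set V) ∩ connEvent ends o x)) /
          prob p (avoidAll ends a₂ {a₁})),
    sum_ite_mem_split (fun W => s3 a₁ a₂ W * (LeafStep.mU p ends a₁ a₂ o / prob p (avoidAll ends a₂ {a₁})) *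
        mZ p ends a₁ a₂ x (connEvent ends v x) W)
      (fun W => prob p (sideEvent EA (clusterEvent ends v (↑W : Set V) ∩ connEvent ends o x)) *
          (prob p (avoidAll ends a₂ {a₁} ∩ connEvent ends x a₁) -
            prob p (avoidAll ends a₂ {a₁} ∩ connEvent ends x a₂))),
    hLb, hLm, Finset.sum_congr rfl (fun W _ => term_x_oA hp h ho h1 h2 _ W),
    Finset.sum_congr rfl (fun W _ => SFg0_x_eq h ho h1 h2 _ W),
    Finset.sum_congr rfl (fun W _ => SuA_o_x_oA h ho h1 h2 W)]
  have e1 : ∑ W : Finset V, s3 a₁ a₂ W * (LeafStep.mU p ends a₁ a₂ o / prob p (avoidAll ends a₂ {a₁})) *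
      Ssig p ends a₁ a₂ x b W =
      (LeafStep.mU p ends a₁ a₂ o / prob p (avoidAll ends a₂ {a₁})) *
        ∑ W : Finset V, s3 a₁ a₂ W * Ssig p ends a₁ a₂ x b W := by
    rw [Finset.mul_sum]
    exact Finset.sum_congr rfl fun W _ => by ring
  have e2 : ∑ W : Finset V, s3 a₁ a₂ W * ((LeafStep.mU p ends a₁ a₂ o / prob p (avoidAll ends a₂ {a₁})) *
      mW p ends a₁ a₂ x W) =
      (LeafStep.mU p ends a₁ a₂ o / prob p (avoidAll ends a₂ {a₁})) *
        ∑ W : Finset V, s3 a₁ a₂ W * mW p ends a₁ a₂ x W := by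
    rw [Finset.mul_sum]
    exact Finset.sum_congr rfl fun W _ => by ring
  rw [e1, e2]
  rw [fibresA, Finset.sum_filter, Finset.sum_filter] at hnb
  rw [hSb, hnb, hD, hA, Finset.sum_const_zero]
  have hz : ∑ W : Finset V, (if a₁ ∉ W ∧ a₂ ∉ W then
      Su p ends a₁ a₂ x b W * Su p ends a₁ a₂ x o W / mW p ends a₁ a₂ x W else 0) = 0 := by
    refine Finset.sum_eq_zero fun W _ => ?_
    split_ifs with hA'
    · rw [Su_o_x_eq h ho h1 h2, s3_eq_zero_of_notMem hA'.1 hA'.2]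
      ring
    · rfl
  rw [hz]
  -- the `d`-sums
  have hd1 : ∑ W : Finset V, (if x ∈ W then 0 else
      (prob p (avoidAll ends a₂ {a₁} ∩ connEvent ends a₁ b) -
          prob p (avoidAll ends a₂ {a₁} ∩ connEvent ends a₂ b)) *
        (prob p (avoidAll ends a₂ {a₁} ∩ connEvent ends x a₁) -
          prob p (avoidAll ends a₂ {a₁} ∩ connEvent ends x a₂)) *
        prob p (sideEvent EA (clusterEvent ends v (↑W : Set V) ∩ connEvent ends o x)) /
        prob p (avoidAll ends a₂ {a₁})) =
      (prob p (avoidAll ends a₂ {a₁} ∩ connEvent ends a₁ b) -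
          prob p (avoidAll ends a₂ {a₁} ∩ connEvent ends a₂ b)) *
        (prob p (avoidAll ends a₂ {a₁} ∩ connEvent ends x a₁) -
          prob p (avoidAll ends a₂ {a₁} ∩ connEvent ends x a₂)) *
        prob p (sideEvent EA ((connEvent ends v x)ᶜ ∩ connEvent ends o x)) /
        prob p (avoidAll ends a₂ {a₁}) := by
    rw [← hd, Finset.mul_sum, Finset.sum_div]
    refine Finset.sum_congr rfl fun W _ => ?_
    split_ifs <;> simp
  have hd2 : ∑ W : Finset V, (if x ∈ W then 0 else
      prob p (sideEvent EA (clusterEvent ends v (↑W : Set V) ∩ connEvent ends o x)) *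
        (prob p (avoidAll ends a₂ {a₁} ∩ connEvent ends x a₁) -
          prob p (avoidAll ends a₂ {a₁} ∩ connEvent ends x a₂))) =
      prob p (sideEvent EA ((connEvent ends v x)ᶜ ∩ connEvent ends o x)) *
        (prob p (avoidAll ends a₂ {a₁} ∩ connEvent ends x a₁) -
          prob p (avoidAll ends a₂ {a₁} ∩ connEvent ends x a₂)) := by
    rw [← hd, Finset.sum_mul]
    refine Finset.sum_congr rfl fun W _ => ?_
    split_ifs <;> simp
  have hd3 : ∑ W : Finset V, (if x ∈ W then 0 else
      (prob p (avoidAll ends a₂ {a₁} ∩ connEvent ends a₁ b) +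
          prob p (avoidAll ends a₂ {a₁} ∩ connEvent ends a₂ b)) *
        (prob p (avoidAll ends a₂ {a₁} ∩ connEvent ends x a₁) +
          prob p (avoidAll ends a₂ {a₁} ∩ connEvent ends x a₂)) *
        prob p (sideEvent EA (clusterEvent ends v (↑W : Set V) ∩ connEvent ends o x)) /
        prob p (avoidAll ends a₂ {a₁})) =
      (prob p (avoidAll ends a₂ {a₁} ∩ connEvent ends a₁ b) +
          prob p (avoidAll ends a₂ {a₁} ∩ connEvent ends a₂ b)) *
        (prob p (avoidAll ends a₂ {a₁} ∩ connEvent ends x a₁) +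
          prob p (avoidAll ends a₂ {a₁} ∩ connEvent ends x a₂)) *
        prob p (sideEvent EA ((connEvent ends v x)ᶜ ∩ connEvent ends o x)) /
        prob p (avoidAll ends a₂ {a₁}) := by
    rw [← hd, Finset.mul_sum, Finset.sum_div]
    refine Finset.sum_congr rfl fun W _ => ?_
    split_ifs <;> simp
  have hd4 : ∑ W : Finset V, (if x ∈ W then 0 else
      prob p (sideEvent EA (clusterEvent ends v (↑W : Set V) ∩ connEvent ends o x)) *
        (prob p (avoidAll ends a₂ {a₁} ∩ connEvent ends x a₁) +
          prob p (avoidAll ends a₂ {a₁} ∩ connEvent ends x a₂))) =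
      prob p (sideEvent EA ((connEvent ends v x)ᶜ ∩ connEvent ends o x)) *
        (prob p (avoidAll ends a₂ {a₁} ∩ connEvent ends x a₁) +
          prob p (avoidAll ends a₂ {a₁} ∩ connEvent ends x a₂)) := by
    rw [← hd, Finset.sum_mul]
    refine Finset.sum_congr rfl fun W _ => ?_
    split_ifs <;> simp
  rw [hd1, hd2, hd3, hd4]
  unfold LeafStep.mU
  set Lb := ∑ W : Finset V, (s3 a₁ a₂ W : R) * Ssig p ends a₁ a₂ x b W with hLbdef
  set Lm := ∑ W : Finset V, (s3 a₁ a₂ W : R) * mW p ends a₁ a₂ x W with hLmdef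
  set nb := ∑ W : Finset V, (if a₁ ∉ W ∧ a₂ ∉ W then Su p ends a₁ a₂ x b W else 0) with hnbdef
  set Dx := prob p (PDEvent ends a₁ a₂ x) with hDxdef
  set Q := prob p (avoidAll ends a₂ {a₁}) with hQdef
  set c := prob p (connEvent ends v x) with hcdef
  set d := prob p (sideEvent EA ((connEvent ends v x)ᶜ ∩ connEvent ends o x)) with hddef
  set xb := prob p (avoidAll ends a₂ {a₁} ∩ connEvent ends a₁ b) with hxb
  set yb := prob p (avoidAll ends a₂ {a₁} ∩ connEvent ends a₂ b) with hyb
  set xo := prob p (avoidAll ends a₂ {a₁} ∩ connEvent ends a₁ o) with hxo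
  set yo := prob p (avoidAll ends a₂ {a₁} ∩ connEvent ends a₂ o) with hyo
  set xx := prob p (avoidAll ends a₂ {a₁} ∩ connEvent ends x a₁) with hxx
  set yx := prob p (avoidAll ends a₂ {a₁} ∩ connEvent ends x a₂) with hyx
  clear_value Lb Lm nb Dx Q c d xb yb xo yo xx yx
  field_simp
  ring

/-- **(FM) behind a cut vertex from (FM) at the cut vertex, `o` on the part's side.** -/
theorem FM_cut_oA_of (hp : IsProbVec p) (h : IsCut ends x ↑VA ↑VB EA EB) (ho : o ∈ VA) (hv : v ∈ VA)
    (h1 : a₁ ∈ insert x VB) (h2 : a₂ ∈ insert x VB) (hb : b ∈ insert x VB)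
    (hx : 0 ≤ FMfun p ends o a₁ a₂ x b) : 0 ≤ FMfun p ends o a₁ a₂ v b := by
  rcases eq_or_ne (prob p (avoidAll ends a₂ {a₁})) 0 with hQ | hQ
  · rw [FMfun_eq_zero_of_prob_Q_eq_zero' hp ends o a₁ a₂ v b hQ]
  · rw [FMfun_cut_oA hp h ho hv h1 h2 hb hQ]
    exact mul_nonneg (prob_nonneg hp _) hx

end OSideClosure

end A3Fibre

end CovForm

end Summit.Ventures.PercRepro2
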